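import Mathlib.NumberTheory.LegendreSymbol.JacobiSymbol
import Mathlib.Data.Rat.Lemmas
import Mathlib.Algebra.Polynomial.Degree.SmallDegree
import Literature.NumberTheory.Sieve.BatemanHornProofs
import Literature.NumberTheory.Sieve.AletheiaZomleferFukshanskyGarcia2020Applications
import Literature.NumberTheory.Sieve.AletheiaZomleferFukshanskyGarcia2020ApplicationsQuadraticProofs
import Literature.NumberTheory.Sieve.ParityBatemanHornProofs
import HarnessLib

/-!
# Aletheia-Zomlefer–Fukshansky–Garcia (2020), §6.5: Hardy–Littlewood's Conjecture F from
# Bateman–Horn — proofs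

Topic `Literature/NumberTheory/Sieve` (family `parity`). Companion ("Proofs", theorems only) file
of `Literature/NumberTheory/Sieve/AletheiaZomleferFukshanskyGarcia2020Applications.lean` for §6.5 of
S. L. Aletheia-Zomlefer, L. Fukshansky, S. R. Garcia, *The Bateman–Horn conjecture: heuristics,
history, and applications*, Expo. Math. 38 (2020) 430–479 = arXiv:1807.08899 (bib key
`AletheiaZomleferFukshanskyGarcia2020`; locators are those of arXiv v4, numbered by subsection);
the siblings `…ApplicationsProofs.lean` / `…ApplicationsQuadraticProofs.lean` hold the §7.2
(prime pairs) proofs and the local root count `ω_f(p)` of §6.5.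

`Literature.NumberTheory.Sieve.HardyLittlewoodConjF` itself (display (6.5.1)) is an OPEN
conjecture — the source poses it as "Hardy–Littlewood Conjecture (F)" and remarks (§6.4, last
paragraph) that "without the Bateman–Horn conjecture or one of its weaker relatives, we do not
even know if any quadratic polynomial produces infinitely many primes"; in the tree it implies
the registered open statements `HardyLittlewoodConjE` (**parity.S37**,
`HardyLittlewoodConjF.conjE`) and hence `LandauConjecture` (**parity.S05**,
`HardyLittlewoodConjE.landauConjecture`). So no `HardyLittlewoodConjF_holds` can exist; this
file proves what §6.5 actually proves around it:

* (input, from the sibling `…ApplicationsQuadraticProofs.lean`: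
  `Literature.NumberTheory.Sieve.polyRootCountMod_quadratic_odd_holds`, the two displays before
  (6.5.3) — for `f = at² + bt + c`, `gcd(a, b, c) = 1` and an odd prime `p`, `ω_f(p) = 0 / 1` if
  `p ∣ a` according as `p ∣ b` or not, and `ω_f(p) = 1 + (Δ/p)` if `p ∤ a`, `Δ = b² − 4ac`);
* `Literature.NumberTheory.Sieve.isBatemanHornSystem_quadratic` — under the hypotheses of
  Conjecture F (`a > 0`, `gcd(a, b, c) = 1`, `a + b`, `c` not both even, `Δ` not a square) the
  single polynomial `at² + bt + c` satisfies the Bateman–Horn hypotheses (§6.5: `Δ` non-square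
  ⇒ irreducible over `ℚ`, primitive ⇒ irreducible over `ℤ` by Gauss's lemma; `ω_f(2) ≤ 1` by
  (6.5.2) and `ω_f(p) ≤ 2 < p` for odd `p`);
* `Literature.NumberTheory.Sieve.batemanHornPartial_quadratic` — display (6.5.3) at the level of
  ordered partial products: for `x ≥ max(2, gcd(a, b))`,
  `∏_{p ≤ x} (1 − 1/p)⁻¹ (1 − ω_f(p)/p) = 2ε · ∏_{p ≥ 3, p ∣ gcd(a,b)} p/(p−1) ·
  ∏_{3 ≤ p ≤ x, p ∤ a} (1 − (Δ/p)/(p−1))`;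
* `Literature.NumberTheory.Sieve.hardyLittlewoodConjF_of_batemanHorn_holds` — DISCHARGE of the
  named fact `hardyLittlewoodConjF_of_batemanHorn`: the Bateman–Horn conjecture implies
  Conjecture F ("This is a consequence of the Bateman–Horn conjecture", §6.5), the positivity of
  the constant coming from the PROVED convergence theorem `exists_hasBatemanHornConst_holds`
  (`BatemanHornProofs.lean`, the source's Theorem 5.4.3);
* `Literature.NumberTheory.Sieve.HardyLittlewoodConjF.landauConjecture` — Conjecture F implies
  Landau's conjecture (the registered open statement **parity.S05**), recording in one
  declaration why Conjecture F cannot be discharged.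

## References

* S. L. Aletheia-Zomlefer, L. Fukshansky, S. R. Garcia, Expo. Math. 38 (2020) 430–479,
  arXiv:1807.08899v4, §6.5 (Hardy–Littlewood Conjecture (F), (6.5.1)–(6.5.3)).
* G. H. Hardy, J. E. Littlewood, Acta Math. 44 (1923), 1–70, Conjecture F.
-/

noncomputable section

open Filter Finset Polynomial Asymptotics
open scoped Topology

namespace Literature.NumberTheory.Sieve

/-! ### §6.5 — `at² + bt + c` satisfies the Bateman–Horn hypotheses -/

section Quadratic

variable {a b c : ℤ}

/-- `gcd(a, b, c) = 1` makes `at² + bt + c` primitive. [folklore] -/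
theorem isPrimitive_quadratic (hgcd : Int.gcd (Int.gcd a b) c = 1) :
    (C a * X ^ 2 + C b * X + C c : ℤ[X]).IsPrimitive := by
  rw [isPrimitive_iff_isUnit_of_C_dvd]
  intro r hr
  rw [C_dvd_iff_dvd_coeff] at hr
  have h2 := hr 2
  have h1 := hr 1
  have h0 := hr 0
  simp only [coeff_add, coeff_C_mul, coeff_X_pow, coeff_X, coeff_C] at h0 h1 h2
  norm_num at h0 h1 h2
  have h : r ∣ (Int.gcd (Int.gcd a b : ℤ) c : ℤ) := Int.dvd_coe_gcd (Int.dvd_coe_gcd h2 h1) h0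
  rw [hgcd] at h
  exact isUnit_of_dvd_one (by exact_mod_cast h)

/-- **§6.5** ("If `Δ` is a perfect square, then the two roots of `f` belong to `ℚ` … Thus `Δ`
cannot be a perfect square if `f` is to be prime infinitely often"), the converse direction
used by Conjecture F: if `Δ = b² − 4ac` is not a perfect square (and `gcd(a, b, c) = 1`,
`a ≠ 0`) then `at² + bt + c` is irreducible in `ℤ[t]` — no rational root since
`(2ar + b)² = Δ` at a root `r`, then Gauss's lemma for the primitive polynomial.
[cite: AletheiaZomleferFukshanskyGarcia2020, §6.5 (paragraph after (6.5.3))] -/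
theorem irreducible_quadratic (ha : a ≠ 0) (hgcd : Int.gcd (Int.gcd a b) c = 1)
    (hΔ : ¬IsSquare (b ^ 2 - 4 * a * c)) :
    Irreducible (C a * X ^ 2 + C b * X + C c : ℤ[X]) := by
  rw [(isPrimitive_quadratic hgcd).irreducible_iff_irreducible_map_fraction_map (K := ℚ)]
  have hmap : (C a * X ^ 2 + C b * X + C c : ℤ[X]).map (algebraMap ℤ ℚ) =
      C (a : ℚ) * X ^ 2 + C (b : ℚ) * X + C (c : ℚ) := by
    simp [Polynomial.map_add, Polynomial.map_mul, Polynomial.map_pow]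
  rw [hmap]
  have ha' : (a : ℚ) ≠ 0 := by exact_mod_cast ha
  have hdeg : (C (a : ℚ) * X ^ 2 + C (b : ℚ) * X + C (c : ℚ)).natDegree = 2 :=
    natDegree_quadratic ha'
  refine (irreducible_iff_roots_eq_zero_of_degree_le_three (by omega) (by omega)).mpr ?_
  refine Multiset.eq_zero_of_forall_notMem fun r hr ↦ ?_
  have hne : (C (a : ℚ) * X ^ 2 + C (b : ℚ) * X + C (c : ℚ)) ≠ 0 := by
    intro h
    rw [h, natDegree_zero] at hdeg
    exact absurd hdeg (by norm_num)
  rw [mem_roots hne, IsRoot.def] at hr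
  simp only [eval_add, eval_mul, eval_C, eval_pow, eval_X] at hr
  refine hΔ (Rat.isSquare_intCast_iff.mp ⟨2 * a * r + b, ?_⟩)
  push_cast
  linear_combination (-4 * (a : ℚ)) * hr

/-- **§6.5**: under the hypotheses of Conjecture F, `f = at² + bt + c` "does not vanish
identically modulo any prime": `ω_f(2) ≤ 1 < 2` by (6.5.2) (`a + b`, `c` not both even) and
`ω_f(p) ≤ 2 < p` for odd `p` by the displays before (6.5.3).
[cite: AletheiaZomleferFukshanskyGarcia2020, §6.5 ((6.5.2) and the displays before (6.5.3))] -/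
theorem hasNoFixedPrimeDivisor_quadratic (ha : 0 < a) (hgcd : Int.gcd (Int.gcd a b) c = 1)
    (hpar : ¬(Even (a + b) ∧ Even c)) :
    HasNoFixedPrimeDivisor ![C a * X ^ 2 + C b * X + C c] := by
  intro p hp
  by_cases h2 : p = 2
  · subst h2
    rw [polyRootCountMod_quadratic_two a b c hpar]
    split_ifs <;> norm_num
  · have hlt : 2 < p := lt_of_le_of_ne hp.two_le (Ne.symm h2)
    have h := polyRootCountMod_quadratic_odd_holds a b c ha hgcd p hp hlt
    have hle : (polyRootCountMod ![C a * X ^ 2 + C b * X + C c] p : ℤ) ≤ 2 := by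
      rw [h]
      split_ifs
      · norm_num
      · norm_num
      · rcases jacobiSym.trichotomy (b ^ 2 - 4 * a * c) p with h0 | h1 | hm1
        · rw [h0]; norm_num
        · rw [h1]; norm_num
        · rw [hm1]; norm_num
    have hp3 : (3 : ℤ) ≤ p := by exact_mod_cast hlt
    have hlt' : (polyRootCountMod ![C a * X ^ 2 + C b * X + C c] p : ℤ) < p := by linarith
    exact_mod_cast hlt'

/-- **§6.5**: under the hypotheses of Hardy–Littlewood's Conjecture F (`a > 0`,
`gcd(a, b, c) = 1`, `a + b` and `c` not both even, `Δ = b² − 4ac` not a square) the single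
polynomial `at² + bt + c` satisfies the hypotheses of the Bateman–Horn conjecture (irreducible,
positive leading coefficient, no fixed prime divisor) — the content of the source's discussion
"paying careful attention to the relevance of Hardy and Littlewood's hypotheses".
[cite: AletheiaZomleferFukshanskyGarcia2020, §6.5 (discussion after (6.5.1))] -/
theorem isBatemanHornSystem_quadratic (ha : 0 < a) (hgcd : Int.gcd (Int.gcd a b) c = 1)
    (hpar : ¬(Even (a + b) ∧ Even c)) (hΔ : ¬IsSquare (b ^ 2 - 4 * a * c)) :
    IsBatemanHornSystem ![C a * X ^ 2 + C b * X + C c] where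
  irreducible i := by
    fin_cases i
    exact irreducible_quadratic ha.ne' hgcd hΔ
  leadingCoeff_pos i := by
    fin_cases i
    show 0 < (C a * X ^ 2 + C b * X + C c : ℤ[X]).leadingCoeff
    rw [leadingCoeff_quadratic ha.ne']
    exact ha
  pairwise_not_associated := Subsingleton.pairwise
  hasNoFixedPrimeDivisor := hasNoFixedPrimeDivisor_quadratic ha hgcd hpar

/-! ### §6.5, display (6.5.3) — the Bateman–Horn product of `at² + bt + c` -/

/-- **§6.5, display (6.5.3)** at the level of ordered partial products: for
`x ≥ max(2, gcd(a, b))`,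
`∏_{p ≤ x} (1 − 1/p)⁻¹ (1 − ω_f(p)/p) = (2 − ω_f(2)) · ∏_{p≥3, p∣a, p∣b} p/(p−1) ·
∏_{p≥3, p∣a, p∤b} (p−1)/(p−1) · ∏_{3 ≤ p ≤ x, p∤a} (p − (1 + (Δ/p)))/(p − 1)
= 2ε ∏_{p≥3, p∣gcd(a,b)} p/(p−1) ∏_{3 ≤ p ≤ x, p∤a} (1 − (Δ/p)/(p−1))`,
`ε = 1/2` if `a + b` is odd and `ε = 1` otherwise.
[cite: AletheiaZomleferFukshanskyGarcia2020, §6.5 (6.5.3)] -/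
theorem batemanHornPartial_quadratic (ha : 0 < a) (hgcd : Int.gcd (Int.gcd a b) c = 1)
    (hpar : ¬(Even (a + b) ∧ Even c)) {x : ℕ} (hx2 : 2 ≤ x) (hxg : Int.gcd a b ≤ x) :
    batemanHornPartial ![C a * X ^ 2 + C b * X + C c] x =
      2 * (if Even (a + b) then 1 else 2⁻¹ : ℝ) *
        (∏ p ∈ (Int.gcd a b).primeFactors.filter (2 < ·), (p : ℝ) / ((p : ℝ) - 1)) *
        ∏ p ∈ (Nat.primesLE x).filter (fun p : ℕ ↦ 2 < p ∧ ¬((p : ℤ) ∣ a)),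
          (1 - (jacobiSym (b ^ 2 - 4 * a * c) p : ℝ) / ((p : ℝ) - 1)) := by
  set f : Fin 1 → ℤ[X] := ![C a * X ^ 2 + C b * X + C c] with hf
  set T : ℕ → ℝ := fun p ↦ (1 - 1 / (p : ℝ))⁻¹ ^ 1 * (1 - (polyRootCountMod f p : ℝ) / p)
    with hT
  have hBH : batemanHornPartial f x = ∏ p ∈ Nat.primesLE x, T p := by
    unfold batemanHornPartial
    rw [Fintype.card_fin]
  have hT2 : T 2 = 2 * (if Even (a + b) then 1 else 2⁻¹ : ℝ) := by
    simp only [hT, hf, polyRootCountMod_quadratic_two a b c hpar]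
    split_ifs <;> norm_num
  have hTa : ∀ p : ℕ, p.Prime → 2 < p → (p : ℤ) ∣ a →
      T p = if (p : ℤ) ∣ b then (p : ℝ) / ((p : ℝ) - 1) else 1 := by
    intro p hp hp2 hpa
    have h := polyRootCountMod_quadratic_odd_holds a b c ha hgcd p hp hp2
    rw [if_pos hpa] at h
    have hp0 : (p : ℝ) ≠ 0 := by exact_mod_cast hp.ne_zero
    have hp1 : (p : ℝ) - 1 ≠ 0 := by
      have : (1 : ℝ) < p := by exact_mod_cast hp.one_lt
      linarith
    by_cases hpb : (p : ℤ) ∣ b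
    · rw [if_pos hpb] at h ⊢
      have hω : (polyRootCountMod f p : ℝ) = 0 := by exact_mod_cast h
      simp only [hT, hω, pow_one, zero_div, sub_zero, mul_one]
      field_simp
    · rw [if_neg hpb] at h ⊢
      have hω : (polyRootCountMod f p : ℝ) = 1 := by exact_mod_cast h
      simp only [hT, hω, pow_one]
      field_simp
  have hTna : ∀ p : ℕ, p.Prime → 2 < p → ¬(p : ℤ) ∣ a →
      T p = 1 - (jacobiSym (b ^ 2 - 4 * a * c) p : ℝ) / ((p : ℝ) - 1) := by
    intro p hp hp2 hpa
    have h := polyRootCountMod_quadratic_odd_holds a b c ha hgcd p hp hp2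
    rw [if_neg hpa] at h
    have hω : (polyRootCountMod f p : ℝ) = 1 + (jacobiSym (b ^ 2 - 4 * a * c) p : ℝ) := by
      have := congrArg (Int.cast : ℤ → ℝ) h
      push_cast at this
      exact this
    have hp0 : (p : ℝ) ≠ 0 := by exact_mod_cast hp.ne_zero
    have hp1 : (p : ℝ) - 1 ≠ 0 := by
      have : (1 : ℝ) < p := by exact_mod_cast hp.one_lt
      linarith
    simp only [hT, hω, pow_one]
    field_simp
    ring
  have hsplit2 : (Nat.primesLE x).filter (fun p : ℕ ↦ ¬2 < p) = {2} := by
    ext p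
    simp only [mem_filter, Nat.mem_primesLE, mem_singleton, not_lt]
    constructor
    · rintro ⟨⟨-, hp⟩, h2⟩
      exact le_antisymm h2 hp.two_le
    · rintro rfl
      exact ⟨⟨hx2, Nat.prime_two⟩, le_rfl⟩
  have hA : ∏ p ∈ (Nat.primesLE x).filter (fun p : ℕ ↦ 2 < p ∧ (p : ℤ) ∣ a), T p =
      ∏ p ∈ (Int.gcd a b).primeFactors.filter (2 < ·), (p : ℝ) / ((p : ℝ) - 1) := by
    have hcongr : ∀ p ∈ (Nat.primesLE x).filter (fun p : ℕ ↦ 2 < p ∧ (p : ℤ) ∣ a),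
        T p = if (p : ℤ) ∣ b then (p : ℝ) / ((p : ℝ) - 1) else 1 := by
      intro p hp
      simp only [mem_filter, Nat.mem_primesLE] at hp
      exact hTa p hp.1.2 hp.2.1 hp.2.2
    rw [prod_congr rfl hcongr, prod_ite, prod_const_one, mul_one]
    refine prod_congr ?_ fun _ _ ↦ rfl
    ext p
    simp only [mem_filter, Nat.mem_primesLE, Nat.mem_primeFactors]
    have hg0 : Int.gcd a b ≠ 0 := fun h ↦ ha.ne' (Int.gcd_eq_zero_iff.mp h).1
    constructor
    · rintro ⟨⟨⟨-, hp⟩, hp2, hpa⟩, hpb⟩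
      exact ⟨⟨hp, Int.dvd_gcd hpa hpb, hg0⟩, hp2⟩
    · rintro ⟨⟨hp, hpg, -⟩, hp2⟩
      have hpg' : (p : ℤ) ∣ (Int.gcd a b : ℤ) := Int.natCast_dvd_natCast.mpr hpg
      exact ⟨⟨⟨(Nat.le_of_dvd (Nat.pos_of_ne_zero hg0) hpg).trans hxg, hp⟩, hp2,
        hpg'.trans (Int.gcd_dvd_left _ _)⟩, hpg'.trans (Int.gcd_dvd_right _ _)⟩
  have hB : ∏ p ∈ (Nat.primesLE x).filter (fun p : ℕ ↦ 2 < p ∧ ¬(p : ℤ) ∣ a), T p =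
      ∏ p ∈ (Nat.primesLE x).filter (fun p : ℕ ↦ 2 < p ∧ ¬(p : ℤ) ∣ a),
        (1 - (jacobiSym (b ^ 2 - 4 * a * c) p : ℝ) / ((p : ℝ) - 1)) := by
    refine prod_congr rfl fun p hp ↦ ?_
    simp only [mem_filter, Nat.mem_primesLE] at hp
    exact hTna p hp.1.2 hp.2.1 hp.2.2
  rw [hBH, ← prod_filter_mul_prod_filter_not (Nat.primesLE x) (fun p : ℕ ↦ 2 < p), hsplit2,
    prod_singleton, hT2, ← prod_filter_mul_prod_filter_not ((Nat.primesLE x).filter (2 < ·))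
      (fun p : ℕ ↦ (p : ℤ) ∣ a), filter_filter, filter_filter, hA, hB]
  ring

/-! ### §6.5 — Bateman–Horn ⇒ Conjecture F -/

/-- `at² + bt + c ≥ t` once `t ≥ |b| + |c| + 1` (`a ≥ 1`). [folklore] -/
theorem le_quadratic_of_le (ha : 0 < a) {t : ℤ} (ht : |b| + |c| + 1 ≤ t) :
    t ≤ a * t ^ 2 + b * t + c := by
  have ht1 : 1 ≤ t := by linarith [abs_nonneg b, abs_nonneg c]
  have h1 : t ^ 2 ≤ a * t ^ 2 := le_mul_of_one_le_left (sq_nonneg t) (by linarith)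
  have h2 : -(|b| * t) ≤ b * t := by nlinarith [neg_abs_le b]
  have h3 : -|c| ≤ c := neg_abs_le c
  have h4 : |c| ≤ t * (t - |b| - 1) := by
    calc |c| = 1 * |c| := (one_mul _).symm
      _ ≤ t * (t - |b| - 1) :=
        mul_le_mul ht1 (by linarith) (abs_nonneg c) (by linarith)
  nlinarith [h1, h2, h3, h4]

/-- **§6.5 — DISCHARGED: the Bateman–Horn conjecture implies Hardy–Littlewood's Conjecture F**
("This is a consequence of the Bateman–Horn conjecture. … If `Δ` is not a perfect square, then
the prediction (eq:Q) of the Bateman–Horn conjecture provides the asymptotic formula (6.5.1)").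
Proof: `f = at² + bt + c` is a Bateman–Horn system (`isBatemanHornSystem_quadratic`), so
Bateman–Horn gives `Q(f; x) ∼ (C/2) x/log x` with `C` the ordered limit of the partial
products, which factor as `2ε · ∏_{p≥3, p∣gcd(a,b)} p/(p−1) · S_x` (display (6.5.3),
`batemanHornPartial_quadratic`); hence `S_x → S = C/(2ε∏)` and `Q(f; x) ∼ ε ∏ S · x/log x`.
Moreover `C > 0` (Theorem 5.4.3, PROVED in the tree as `exists_hasBatemanHornConst_holds`), so
`Q(f; x) → ∞`, and since `f(t) ≥ t` for large `t` the prime values `f(t)` are unbounded: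
infinitely many primes of the form `at² + bt + c`.
[cite: AletheiaZomleferFukshanskyGarcia2020, §6.5 ((6.5.1) from (eq:Q) via (6.5.3))] -/
theorem hardyLittlewoodConjF_of_batemanHorn_holds : hardyLittlewoodConjF_of_batemanHorn := by
  intro hBH a b c ha hgcd hpar hΔ
  have hsys := isBatemanHornSystem_quadratic ha hgcd hpar hΔ
  obtain ⟨C₀, hC₀, hQ⟩ := hBH 1 _ hsys
  obtain ⟨C₁, hC₁pos, hC₁⟩ := exists_hasBatemanHornConst_holds hsys
  have hCpos : 0 < C₀ := by rwa [tendsto_nhds_unique hC₀ hC₁]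
  have hdeg : (C a * X ^ 2 + C b * X + C c : ℤ[X]).natDegree = 2 := natDegree_quadratic ha.ne'
  set ε : ℝ := (if Even (a + b) then 1 else 2⁻¹ : ℝ) with hε
  set P : ℝ := ∏ p ∈ (Int.gcd a b).primeFactors.filter (2 < ·), (p : ℝ) / ((p : ℝ) - 1)
    with hP
  have hεpos : 0 < ε := by
    rw [hε]
    split_ifs <;> norm_num
  have hPpos : 0 < P := by
    rw [hP]
    refine prod_pos fun p hp ↦ ?_
    have hp2 : (2 : ℝ) < p := by exact_mod_cast (mem_filter.mp hp).2
    exact div_pos (by linarith) (by linarith)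
  have hfac : ∀ᶠ x : ℕ in atTop, batemanHornPartial ![C a * X ^ 2 + C b * X + C c] x =
      2 * ε * P * ∏ p ∈ (Nat.primesLE x).filter (fun p : ℕ ↦ 2 < p ∧ ¬((p : ℤ) ∣ a)),
        (1 - (jacobiSym (b ^ 2 - 4 * a * c) p : ℝ) / ((p : ℝ) - 1)) := by
    filter_upwards [eventually_ge_atTop (max 2 (Int.gcd a b))] with x hx
    exact batemanHornPartial_quadratic ha hgcd hpar (le_of_max_le_left hx) (le_of_max_le_right hx)
  have hC₀' : Tendsto (batemanHornPartial ![C a * X ^ 2 + C b * X + C c]) atTop (𝓝 C₀) := hC₀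
  have hS : Tendsto (fun x : ℕ ↦ ∏ p ∈ (Nat.primesLE x).filter (fun p : ℕ ↦ 2 < p ∧ ¬((p : ℤ) ∣ a)),
      (1 - (jacobiSym (b ^ 2 - 4 * a * c) p : ℝ) / ((p : ℝ) - 1))) atTop
      (𝓝 (C₀ / (2 * ε * P))) := by
    refine (hC₀'.div_const (2 * ε * P)).congr' ?_
    filter_upwards [hfac] with x hx
    rw [hx]
    field_simp
  have hlim : Tendsto (fun x : ℕ ↦ (polyPrimeCount ![C a * X ^ 2 + C b * X + C c] x : ℝ))
      atTop atTop := by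
    refine hQ.symm.tendsto_atTop ?_
    have h := tendsto_natCast_div_log_atTop.const_mul_atTop (show (0 : ℝ) < C₀ / 2 by positivity)
    refine h.congr fun x ↦ ?_
    simp only [Finset.univ_unique, Fin.default_eq_zero, prod_singleton, Matrix.cons_val_zero,
      hdeg, Fintype.card_fin, pow_one, Nat.cast_ofNat]
    ring
  refine ⟨?_, C₀ / (2 * ε * P), hS, ?_⟩
  · refine Set.infinite_of_forall_exists_gt fun n ↦ ?_
    by_contra hcon
    push Not at hcon
    set M : ℕ := n + b.natAbs + c.natAbs + 1 with hM
    have hbound : ∀ x, (polyPrimeCount ![C a * X ^ 2 + C b * X + C c] x : ℝ) ≤ M := by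
      intro x
      unfold polyPrimeCount
      have hcard : #((range (x + 1)).filter fun t : ℕ ↦
          ∀ i, 0 < (![C a * X ^ 2 + C b * X + C c] i).eval (t : ℤ) ∧
            ((![C a * X ^ 2 + C b * X + C c] i).eval (t : ℤ)).toNat.Prime) ≤ #(range M) := by
        refine card_le_card fun t ht ↦ ?_
        simp only [mem_filter, mem_range, Fin.forall_fin_one, Matrix.cons_val_zero, eval_add,
          eval_mul, eval_C, eval_pow, eval_X] at ht
        obtain ⟨-, hpos, hprime⟩ := ht
        rw [mem_range]
        by_contra htM
        push Not at htM
        have hle : (a * (t : ℤ) ^ 2 + b * t + c).toNat ≤ n :=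
          hcon _ ⟨hprime, t, Int.toNat_of_nonneg hpos.le⟩
        have htM' : |b| + |c| + 1 ≤ (t : ℤ) := by
          have h1 : (M : ℤ) ≤ t := by exact_mod_cast htM
          have h2 : (M : ℤ) = n + |b| + |c| + 1 := by simp [hM]
          linarith [h1, h2, (Int.natCast_nonneg n : (0 : ℤ) ≤ n)]
        have hge := le_quadratic_of_le (b := b) (c := c) ha htM'
        have h3 : (t : ℤ) ≤ n :=
          calc (t : ℤ) ≤ a * (t : ℤ) ^ 2 + b * t + c := hge
            _ = ((a * (t : ℤ) ^ 2 + b * t + c).toNat : ℤ) := (Int.toNat_of_nonneg hpos.le).symm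
            _ ≤ n := by exact_mod_cast hle
        have h4 : t ≤ n := by exact_mod_cast h3
        omega
      exact_mod_cast hcard.trans (card_range M).le
    obtain ⟨x, hx⟩ := (hlim.eventually (eventually_gt_atTop (M : ℝ))).exists
    exact absurd hx (not_lt.mpr (hbound x))
  · refine hQ.congr_right (Eventually.of_forall fun x ↦ ?_)
    simp only [Finset.univ_unique, Fin.default_eq_zero, prod_singleton, Matrix.cons_val_zero,
      hdeg, Fintype.card_fin, pow_one, Nat.cast_ofNat]
    have hε0 : ε ≠ 0 := hεpos.ne'
    have hP0 : P ≠ 0 := hPpos.ne'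
    field_simp

end Quadratic

/-! ### Conjecture F is open: it implies Landau's problem -/

/-- Conjecture F specialises (`a = 1`, `b = 0`, `c = 1`) to Hardy–Littlewood's Conjecture E
(`HardyLittlewoodConjF.conjE`, §6.5 with §3.4 of the source) and hence implies Landau's
conjecture that `n² + 1` is prime for infinitely many `n` (§6.2; the tree's registered open
statement **parity.S05**, `LandauConjecture`, via `HardyLittlewoodConjE.landauConjecture`):
Conjecture F is an OPEN problem, at least as hard as Landau's.
[cite: AletheiaZomleferFukshanskyGarcia2020, §6.2 and §6.5] -/
theorem HardyLittlewoodConjF.landauConjecture (h : HardyLittlewoodConjF) :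
    Sieve.LandauConjecture :=
  h.conjE.landauConjecture

end Literature.NumberTheory.Sieve

end
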